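/-
Copyright: fleet lead `ym-wcr-19609-p1` (seat prover-ym-wcr-19609-p1-g0-0), route `WeakCouplingRates`; cross-filed for route
`ThermalRuler`, crux `SofteningCentreBlind` (stmt-QuantumFields-10418), birth line stub F1.
-/
import Summits.QuantumFields.YangMills.Theorems.WeakCouplingRatesCurvatureCorrPowerFloor

/-!
# Registered stub F1 `stub_curvatureCorrFloor` of crux `SofteningCentreBlind` (stmt-QuantumFields-10418, route ThermalRuler), BY NAME

The birth line of crux `SofteningCentreBlind` (`Cruxes/SofteningCentreBlind/Lines/birth.lean`) registers stub F1
`stub_curvatureCorrFloor : ∃ κ > 0, ∃ n₀, ∀ n ≥ n₀, κ / n⁴ ≤ |curvaturePlaquetteCorr (d := 4) _ n|` — the eventual power floor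
of the `ℤ⁴` lattice-Maxwell curvature plaquette two-point function along the `e₀` axis.  It is, symbol for symbol, the body of the
support item FLOOR `CurvatureCorrPowerFloor` of route `WeakCouplingRates` (stmt-QuantumFields-19457), PROVED as
`Theorems.WeakCouplingRates.curvatureCorrPowerFloor_proof` (module `WeakCouplingRatesCurvatureCorrPowerFloor`: `c_n = ⅓∇²_{e₀}G(ne₀)`
by `EquipartitionPinsProbe.stub_secondDifference`, then Lawler's Thm. 1.5.5 (1.37) `latticeGreen_second_diff_continuum`; `κ = 1/(2π²)`).
This file is the one-line identification for the ThermalRuler registry.  NOT a claim about the mass gap.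

References: G. F. Lawler, *Intersections of Random Walks* (1991), Thm. 1.5.5.
-/

set_option autoImplicit false

namespace Summit.QuantumFields.YangMills.Theorems.ThermalRuler

/-- **Registered stub F1 `stub_curvatureCorrFloor` of crux `stmt-QuantumFields-10418` (`SofteningCentreBlind`, route ThermalRuler)**,
by name and signature — the `ℤ⁴` lattice-Maxwell curvature two-point power floor, `= Theorems.WeakCouplingRates.curvatureCorrPowerFloor_proof`.
[cite: Lawler1991, Thm. 1.5.5] -/
theorem stub_curvatureCorrFloor :
    ∃ κ : ℝ, 0 < κ ∧ ∃ n₀ : ℕ, ∀ n : ℕ, n₀ ≤ n → κ / (n : ℝ) ^ 4 ≤ |Literature.MathematicalPhysics.QuantumFieldTheory.curvaturePlaquetteCorr (d := 4) (by norm_num) (n : ℤ)| :=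
  Summit.QuantumFields.YangMills.Theorems.WeakCouplingRates.curvatureCorrPowerFloor_proof

end Summit.QuantumFields.YangMills.Theorems.ThermalRuler
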